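import Literature.NumberTheory.GaloisRepresentations.ContinuousCohomologyNineTerm
import Literature.NumberTheory.GaloisCohomology.PoitouTateRealPlacesHigherDegree
import HarnessLib

/-!
# Poitou–Tate in degree `3` at the real places is INHERITED BY EXTENSIONS of Galois modules
# (dévissage step for Milne I Thm. 4.10 (c), `r = 3`; K4 `SignedControlAtTwo` stub 3 `stub_poitouTateThreeRealRat`)

Route `ThetaPartnerAtTwo` (TP2; crux shared with `ResidualThetaTransportAtTwo`), crux K4 `SignedControlAtTwo`
(stmt-BirchSwinnertonDyer-20309), line `eulerchar` v12, registered stub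
`stub_poitouTateThreeRealRat : poitouTate_three_realPlaces_injective ℚ` (Milne, *ADT*, I Thm. 4.10 (c) for
`r = 3`: a class of `H³(K, M)` vanishing at every real place is `0`).  Seat `prover-bsd-wall-tp2-p3` (lead, gen 5).

This file is the EXTENSION STEP of a 2-primary dévissage of that named fact (all finite `M` ⟸ `M = ℤ/2`):
for a short exact sequence `0 → M₁ →ᶠ M₂ →ᵍ M₃ → 0` of discrete `Γ_K`-modules over a number field `K`,

* §1 `IsSES.eq_zero_of_forall_localization_inl_three` — if (h1) `H³(K, M₁) → ∏_{w real} H³(K_w, M₁)` is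
  injective, (h3) the same for `M₃`, and (h2) `H²(K, M₃) → ∏_{w real} H²(K_w, M₃)` is surjective (Milne I
  Cor. 4.16 AT `M₃`), then `H³(K, M₂) → ∏_{w real} H³(K_w, M₂)` is injective.  (The four-lemma on the ladder
  `H²(M₃) → H³(M₁) → H³(M₂) → H³(M₃)` over `K` and over the `K_w`, made cochain-level because the tree's long
  exact sequence of `IsSES` stops at `H²`: for `x = [z] ∈ H³(K, M₂)` locally trivial at the real places,
  `g_*x` is locally trivial hence `0` (h3), so `g ∘ z = dβ` and `z' = z - d β̃ = f ∘ a` with `a ∈ Z³(M₁)`,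
  `f_*[a] = x`; at a real `w`, `z'|_w = dγ_w` and `g ∘ γ_w ∈ Z²(K_w, M₃)`; by (h2) one global `c = [ψ]` has
  `[ψ|_w] = [g ∘ γ_w]` at every real `w`; the connecting cocycle `e = f⁻¹(d ψ̃)` gives `a' = a - e` with
  `f_*[a'] = x` and `a'|_w = d(f⁻¹(γ_w - ψ̃|_w + dθ̃_w))`, so `[a']` is locally trivial, `[a'] = 0` (h1), `x = 0`.)
* §2 `realThree_injective_of_extension` — the same with the hypotheses (h1), (h3), (h2) spelled as the
  PER-MODULE instances of the tree's named facts `poitouTate_three_realPlaces_injective` /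
  `poitouTate_two_realPlaces_surjective` (file `PoitouTateRealPlacesHigherDegree.lean`), the shape a dévissage
  consumes (`M₃ = ℤ/2` with trivial action in the 2-group filtration; `M₃ = M/M[2^∞]` for the odd part).

HONEST FRAMING: THEOREMS ONLY (no definition, no named fact, no `sorry`); nothing here is specific to elliptic
curves; closes no item by itself (the base case `M = ℤ/2` — `H³(F, ℤ/2) ↪ ⊕_{w real} H³(F_w, ℤ/2)` for number
fields `F`, i.e. `Br(F)/2 ≅ ⊕_{real} ℤ/2` with `H³(F, 𝔾_m)[2] = 0` — and the odd-index descent are separate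
files); BSD is not proved by any of this.

References: [MilneADT2006] I Thm. 4.10 (c), Cor. 4.16 (p. 57, p. 62); [SerreGaloisCohomology1997] I §2.2–2.3
(inhomogeneous cochains, functoriality); [Harari2020] Thm. 17.13 (a).
-/

set_option autoImplicit false
-- the Theorems namespace of this sub repeats the summit name by design (D-0017 nested layout)
set_option linter.dupNamespace false

noncomputable section

open CategoryTheory NumberField Field Function
open _root_.TopRep _root_.ContRepresentation _root_.ContinuousCohomology
open Literature.NumberTheory.GaloisRepresentations
open Literature.NumberTheory.GaloisCohomology

universe u v

namespace Summit.BirchSwinnertonDyer.BirchSwinnertonDyer.Theorems.SignedEC.ShaThree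

/-! ## §0 `H³(f)` on explicit `3`-cocycles -/

section HelpersThree

variable {k : Type u} [CommRing k] [TopologicalSpace k]
variable {G : Type v} [Group G] [TopologicalSpace G] [IsTopologicalGroup G] [LocallyCompactSpace G]

/-- `H³(f) [c] = [f ∘ c]` on inhomogeneous continuous `3`-cocycles (degree-`3` twin of the tree's
`cohomologyMap_twoCocycleClass`). [cite: SerreGaloisCohomology1997, I §2.2] -/
theorem cohomologyMap_threeCocycleClass {A B : TopRep.{v} k G} (f : A ⟶ B) (c : contThreeCocycles A) :
    cohomologyMap f 3 (threeCocycleClass A c) =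
      threeCocycleClass B (contThreeCocycles.pullback (ContinuousMonoidHom.id G) (resIdHom f) c) :=
  map_threeCocycleClass _ _ _ c

omit [IsTopologicalGroup G] [LocallyCompactSpace G] in
/-- `(f ∘ c)(σ, τ, υ) = f (c(σ, τ, υ))` for the pulled-back `3`-cocycle along the identity. [folklore] -/
@[simp] theorem pullback₃_id_resIdHom_apply {A B : TopRep.{v} k G} (f : A ⟶ B)
    (c : contThreeCocycles A) (σ τ υ : G) :
    (contThreeCocycles.pullback (ContinuousMonoidHom.id G) (resIdHom f) c).1 (σ, τ, υ) =
      f.hom (c.1 (σ, τ, υ)) := rfl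

end HelpersThree

/-! ## §1 The extension step, cochain-level -/

section Extension

variable {K : Type} [Field K] [NumberField K]
variable {M₁ M₂ M₃ : Type} [AddCommGroup M₁] [TopologicalSpace M₁] [DiscreteTopology M₁]
  [AddCommGroup M₂] [TopologicalSpace M₂] [DiscreteTopology M₂]
  [AddCommGroup M₃] [TopologicalSpace M₃] [DiscreteTopology M₃]
variable {ρ₁ : DiscreteGaloisModule K M₁} {ρ₂ : DiscreteGaloisModule K M₂} {ρ₃ : DiscreteGaloisModule K M₃}
variable {f : ρ₁.toTopRep ⟶ ρ₂.toTopRep} {g : ρ₂.toTopRep ⟶ ρ₃.toTopRep}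

/-- **Milne I Thm. 4.10 (c)₃ is inherited by extensions.**  Let `0 → M₁ →ᶠ M₂ →ᵍ M₃ → 0` be a short exact
sequence of discrete `Γ_K`-modules over a number field `K`.  If every class of `H³(K, M₁)` (resp. `H³(K, M₃)`)
vanishing at all real places is zero, and every family of classes in `H²(K_w, M₃)` at the infinite places is,
at the real places, the localisation of one class of `H²(K, M₃)` (Milne I Cor. 4.16 at `M₃`), then every class
of `H³(K, M₂)` vanishing at all real places is zero.
[cite: MilneADT2006, Ch. I, Thm. 4.10 (c) and Cor. 4.16] [cite: SerreGaloisCohomology1997, I §2.2] -/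
theorem IsSES.eq_zero_of_forall_localization_inl_three (h : IsSES f g)
    (h1 : ∀ a : galoisCohomology ρ₁ 3,
      (∀ w : InfinitePlace K, w.IsReal → galoisCohomology.localization ρ₁ (Sum.inl w) 3 a = 0) → a = 0)
    (h3 : ∀ y : galoisCohomology ρ₃ 3,
      (∀ w : InfinitePlace K, w.IsReal → galoisCohomology.localization ρ₃ (Sum.inl w) 3 y = 0) → y = 0)
    (h2 : ∀ r : (∀ w : InfinitePlace K, galoisCohomology (ρ₃.toLocal (Sum.inl w)) 2),
      ∃ c : galoisCohomology ρ₃ 2,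
        ∀ w : InfinitePlace K, w.IsReal → galoisCohomology.localization ρ₃ (Sum.inl w) 2 c = r w)
    (x : galoisCohomology ρ₂ 3)
    (hx : ∀ w : InfinitePlace K, w.IsReal → galoisCohomology.localization ρ₂ (Sum.inl w) 3 x = 0) :
    x = 0 := by
  classical
  haveI : CompactSpace (absoluteGaloisGroup K) := absoluteGaloisGroup_compactSpace K
  haveI : ∀ w : InfinitePlace K, CompactSpace (absoluteGaloisGroup (Place.Completion (Sum.inl w : Place K))) :=
    fun w => absoluteGaloisGroup_compactSpace _
  -- localisation on explicit cocycles (degrees 2 and 3)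
  have loc₂ : ∀ {N : Type} [AddCommGroup N] [TopologicalSpace N] [DiscreteTopology N]
      (τ : DiscreteGaloisModule K N) (w : InfinitePlace K) (d : contTwoCocycles τ.toTopRep),
      galoisCohomology.localization τ (Sum.inl w) 2 (twoCocycleClass τ.toTopRep d) =
        twoCocycleClass (DiscreteGaloisModule.toTopRep (τ.toLocal (Sum.inl w)))
          (contTwoCocycles.pullback (absGaloisRestrict K (Place.Completion (Sum.inl w : Place K)))
            (X := τ.toTopRep) (Y := DiscreteGaloisModule.toTopRep (τ.toLocal (Sum.inl w)))
            (TopRep.ofHom ⟨ContinuousLinearMap.id ℤ N, fun _ => rfl⟩) d) :=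
    fun τ w d ↦ map_twoCocycleClass _ _ _ d
  have loc₃ : ∀ {N : Type} [AddCommGroup N] [TopologicalSpace N] [DiscreteTopology N]
      (τ : DiscreteGaloisModule K N) (w : InfinitePlace K) (d : contThreeCocycles τ.toTopRep),
      galoisCohomology.localization τ (Sum.inl w) 3 (threeCocycleClass τ.toTopRep d) =
        threeCocycleClass (DiscreteGaloisModule.toTopRep (τ.toLocal (Sum.inl w)))
          (contThreeCocycles.pullback (absGaloisRestrict K (Place.Completion (Sum.inl w : Place K)))
            (X := τ.toTopRep) (Y := DiscreteGaloisModule.toTopRep (τ.toLocal (Sum.inl w)))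
            (TopRep.ofHom ⟨ContinuousLinearMap.id ℤ N, fun _ => rfl⟩) d) :=
    fun τ w d ↦ map_threeCocycleClass _ _ _ d
  -- notation for the local groups and the fixed maps `r_w : Γ_{K_w} → Γ_K`
  set Γ := absoluteGaloisGroup K with hΓ
  let Γl : InfinitePlace K → Type := fun w => absoluteGaloisGroup (Place.Completion (Sum.inl w : Place K))
  let r : ∀ w : InfinitePlace K, Γl w →ₜ* Γ := fun w => absGaloisRestrict K (Place.Completion (Sum.inl w : Place K))
  obtain ⟨z, rfl⟩ := threeCocycleClass_surjective _ x
  /- Step 1: `g ∘ z` is locally trivial at the real places, hence (h3) a coboundary `dβ`; the corrected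
  cocycle `z' = z - dβ̃` (same class) takes values in `ker g = im f`: `z' = f ∘ a`, `a ∈ Z³(Γ_K, M₁)`. -/
  have hgz : threeCocycleClass ρ₃.toTopRep
      (contThreeCocycles.pullback (ContinuousMonoidHom.id Γ) (resIdHom g) z) = 0 := by
    refine h3 _ fun w hw => ?_
    have hxw := hx w hw
    rw [loc₃] at hxw ⊢
    obtain ⟨γ, hγ⟩ := (threeCocycleClass_eq_zero_iff_dTwo _ _).1 hxw
    refine (threeCocycleClass_eq_zero_iff_dTwo _ _).2
      ⟨(⟨g.hom, g.hom.continuous⟩ : C(M₂, M₃)).comp γ, fun σ τ υ => ?_⟩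
    have hγ' : z.1 (r w σ, r w τ, r w υ) =
        dTwo (DiscreteGaloisModule.toTopRep (ρ₂.toLocal (Sum.inl w))) γ σ τ υ := hγ σ τ υ
    change g.hom (z.1 (r w σ, r w τ, r w υ)) = _
    rw [hγ', dTwo_apply, dTwo_apply, map_sub, map_add, map_sub]
    change g.hom (ρ₂ (r w σ) (γ (τ, υ))) - _ + _ - _ = ρ₃ (r w σ) (g.hom (γ (τ, υ))) - _ + _ - _
    rw [ContinuousRep.hom_comm_apply g (r w σ)]
    rfl
  obtain ⟨β, hβ⟩ := (threeCocycleClass_eq_zero_iff_dTwo _ _).1 hgz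
  have hβ' : ∀ σ τ υ, g.hom (z.1 (σ, τ, υ)) = dTwo ρ₃.toTopRep β σ τ υ := fun σ τ υ => hβ σ τ υ
  let βt : C(Γ × Γ, M₂) := ⟨h.lift ∘ β, (continuous_of_discreteTopology (f := h.lift)).comp β.continuous⟩
  have hβt : ∀ p, g.hom (βt p) = β p := fun p => h.g_lift _
  have hgd : ∀ (b : C(Γ × Γ, M₂)) (σ τ υ : Γ), g.hom (dTwo ρ₂.toTopRep b σ τ υ) =
      dTwo ρ₃.toTopRep ((⟨g.hom, g.hom.continuous⟩ : C(M₂, M₃)).comp b) σ τ υ := fun b σ τ υ => by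
    rw [dTwo_apply, dTwo_apply, map_sub, map_add, map_sub, TopRep.hom_comm_apply g σ]
    rfl
  let dβ : contThreeCocycles ρ₂.toTopRep :=
    ⟨⟨fun p => dTwo ρ₂.toTopRep βt p.1 p.2.1 p.2.2, IsSES.continuous_dTwo βt⟩,
      IsSES.dTwo_mem_contThreeCocycles βt⟩
  have hdβ : threeCocycleClass ρ₂.toTopRep dβ = 0 :=
    (threeCocycleClass_eq_zero_iff_dTwo _ _).2 ⟨βt, fun _ _ _ => rfl⟩
  let z' : contThreeCocycles ρ₂.toTopRep := z - dβ
  have hz' : ∀ σ τ υ, z'.1 (σ, τ, υ) = z.1 (σ, τ, υ) - dTwo ρ₂.toTopRep βt σ τ υ := fun _ _ _ => rfl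
  have hz'g : ∀ p, g.hom (z'.1 p) = 0 := fun ⟨σ, τ, υ⟩ => by
    rw [hz', map_sub, hβ', hgd, sub_eq_zero]
    congr 1
    exact ContinuousMap.ext fun p => (hβt p).symm
  let a : contThreeCocycles ρ₁.toTopRep :=
    ⟨⟨h.inv ∘ z'.1, (continuous_of_discreteTopology (f := h.inv)).comp z'.1.continuous⟩, fun σ τ υ ω => by
      apply h.injective
      have key := z'.2 σ τ υ ω
      change ρ₂ σ (z'.1 (τ, υ, ω)) + z'.1 (σ, τ * υ, ω) + z'.1 (σ, τ, υ) =
        z'.1 (σ * τ, υ, ω) + z'.1 (σ, τ, υ * ω) at key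
      change f.hom (ρ₁ σ (h.inv (z'.1 (τ, υ, ω))) + h.inv (z'.1 (σ, τ * υ, ω)) + h.inv (z'.1 (σ, τ, υ))) =
        f.hom (h.inv (z'.1 (σ * τ, υ, ω)) + h.inv (z'.1 (σ, τ, υ * ω)))
      rw [map_add, map_add, map_add, ContinuousRep.hom_comm_apply f σ, h.f_inv (hz'g _), h.f_inv (hz'g _),
        h.f_inv (hz'g _), h.f_inv (hz'g _), h.f_inv (hz'g _)]
      exact key⟩
  have hfa : ∀ p, f.hom (a.1 p) = z'.1 p := fun p => h.f_inv (hz'g p)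
  /- Step 2: at each real place `w`, `z'|_w = dγ_w` with `g ∘ γ_w ∈ Z²(K_w, M₃)`. -/
  have hloc' : ∀ w : InfinitePlace K, w.IsReal → ∃ γ : C(Γl w × Γl w, M₂), ∀ σ τ υ,
      z'.1 (r w σ, r w τ, r w υ) = dTwo (DiscreteGaloisModule.toTopRep (ρ₂.toLocal (Sum.inl w))) γ σ τ υ := by
    intro w hw
    have hxw := hx w hw
    rw [loc₃] at hxw
    obtain ⟨γ, hγ⟩ := (threeCocycleClass_eq_zero_iff_dTwo _ _).1 hxw
    refine ⟨γ - βt.comp ((r w : C(Γl w, Γ)).prodMap (r w : C(Γl w, Γ))), fun σ τ υ => ?_⟩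
    have hγ' : z.1 (r w σ, r w τ, r w υ) =
        dTwo (DiscreteGaloisModule.toTopRep (ρ₂.toLocal (Sum.inl w))) γ σ τ υ := hγ σ τ υ
    rw [dTwo_sub, hz', hγ']
    congr 1
    rw [dTwo_apply, dTwo_apply]
    change _ = ρ₂ (r w σ) (βt (r w τ, r w υ)) - βt (r w (σ * τ), r w υ) + βt (r w σ, r w (τ * υ)) -
      βt (r w σ, r w τ)
    rw [map_mul, map_mul]
    rfl
  choose γ hγ using hloc'
  -- the local `2`-cocycles `g ∘ γ_w` and the family `r` fed to (h2)
  have hgγ : ∀ (w : InfinitePlace K) (hw : w.IsReal),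
      (⟨g.hom, g.hom.continuous⟩ : C(M₂, M₃)).comp (γ w hw) ∈
        contTwoCocycles (DiscreteGaloisModule.toTopRep (ρ₃.toLocal (Sum.inl w))) := fun w hw => by
    refine (mem_contTwoCocycles_iff_dTwo _ _).2 fun σ τ υ => ?_
    have e1 : dTwo (DiscreteGaloisModule.toTopRep (ρ₃.toLocal (Sum.inl w)))
        ((⟨g.hom, g.hom.continuous⟩ : C(M₂, M₃)).comp (γ w hw)) σ τ υ =
        g.hom (dTwo (DiscreteGaloisModule.toTopRep (ρ₂.toLocal (Sum.inl w))) (γ w hw) σ τ υ) := by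
      rw [dTwo_apply, dTwo_apply, map_sub, map_add, map_sub]
      change ρ₃ (r w σ) (g.hom (γ w hw (τ, υ))) - _ + _ - _ = g.hom (ρ₂ (r w σ) (γ w hw (τ, υ))) - _ + _ - _
      rw [ContinuousRep.hom_comm_apply g (r w σ)]
      rfl
    rw [e1, ← hγ w hw, hz'g]
  let rr : ∀ w : InfinitePlace K, galoisCohomology (ρ₃.toLocal (Sum.inl w)) 2 := fun w =>
    if hw : w.IsReal then
      twoCocycleClass (DiscreteGaloisModule.toTopRep (ρ₃.toLocal (Sum.inl w))) ⟨_, hgγ w hw⟩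
    else 0
  have hrr : ∀ (w : InfinitePlace K) (hw : w.IsReal),
      rr w = twoCocycleClass (DiscreteGaloisModule.toTopRep (ρ₃.toLocal (Sum.inl w))) ⟨_, hgγ w hw⟩ :=
    fun w hw => dif_pos hw
  /- Step 3: one global `c = [ψ] ∈ H²(K, M₃)` with `[ψ|_w] = [g ∘ γ_w]` at the real places (h2); its connecting
  cocycle `e = f⁻¹(dψ̃) ∈ Z³(Γ_K, M₁)`. -/
  obtain ⟨c, hc⟩ := h2 rr
  obtain ⟨ψ, rfl⟩ := twoCocycleClass_surjective _ c
  let ψt : C(Γ × Γ, M₂) := ⟨h.lift ∘ ψ.1, (continuous_of_discreteTopology (f := h.lift)).comp ψ.1.continuous⟩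
  have hψt : ∀ p, g.hom (ψt p) = ψ.1 p := fun p => h.g_lift _
  have hdψ : ∀ σ τ υ, g.hom (dTwo ρ₂.toTopRep ψt σ τ υ) = 0 := fun σ τ υ => by
    rw [dTwo_apply, map_sub, map_add, map_sub, TopRep.hom_comm_apply g σ, hψt, hψt, hψt, hψt]
    exact dTwo_coe_contTwoCocycles ρ₃.toTopRep ψ σ τ υ
  let e : contThreeCocycles ρ₁.toTopRep :=
    ⟨⟨fun p => h.inv (dTwo ρ₂.toTopRep ψt p.1 p.2.1 p.2.2),
        (continuous_of_discreteTopology (f := h.inv)).comp (IsSES.continuous_dTwo ψt)⟩, fun σ τ υ ω => by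
      apply h.injective
      have key := IsSES.dTwo_mem_contThreeCocycles (ρ₂ := ρ₂) ψt σ τ υ ω
      change ρ₂ σ (dTwo ρ₂.toTopRep ψt τ υ ω) + dTwo ρ₂.toTopRep ψt σ (τ * υ) ω +
          dTwo ρ₂.toTopRep ψt σ τ υ =
        dTwo ρ₂.toTopRep ψt (σ * τ) υ ω + dTwo ρ₂.toTopRep ψt σ τ (υ * ω) at key
      change f.hom (ρ₁ σ (h.inv (dTwo ρ₂.toTopRep ψt τ υ ω)) + h.inv (dTwo ρ₂.toTopRep ψt σ (τ * υ) ω) +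
          h.inv (dTwo ρ₂.toTopRep ψt σ τ υ)) =
        f.hom (h.inv (dTwo ρ₂.toTopRep ψt (σ * τ) υ ω) + h.inv (dTwo ρ₂.toTopRep ψt σ τ (υ * ω)))
      rw [map_add, map_add, map_add, ContinuousRep.hom_comm_apply f σ, h.f_inv (hdψ _ _ _),
        h.f_inv (hdψ _ _ _), h.f_inv (hdψ _ _ _), h.f_inv (hdψ _ _ _), h.f_inv (hdψ _ _ _)]
      exact key⟩
  have hfe : ∀ σ τ υ, f.hom (e.1 (σ, τ, υ)) = dTwo ρ₂.toTopRep ψt σ τ υ := fun σ τ υ => h.f_inv (hdψ σ τ υ)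
  /- Step 4: `a' = a - e` still satisfies `f_*[a'] = x`. -/
  let a' : contThreeCocycles ρ₁.toTopRep := a - e
  have ha' : ∀ σ τ υ, a'.1 (σ, τ, υ) = a.1 (σ, τ, υ) - e.1 (σ, τ, υ) := fun _ _ _ => rfl
  let dψ : contThreeCocycles ρ₂.toTopRep :=
    ⟨⟨fun p => dTwo ρ₂.toTopRep ψt p.1 p.2.1 p.2.2, IsSES.continuous_dTwo ψt⟩,
      IsSES.dTwo_mem_contThreeCocycles ψt⟩
  have hdψ0 : threeCocycleClass ρ₂.toTopRep dψ = 0 :=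
    (threeCocycleClass_eq_zero_iff_dTwo _ _).2 ⟨ψt, fun _ _ _ => rfl⟩
  have hfa' : cohomologyMap f 3 (threeCocycleClass ρ₁.toTopRep a') = threeCocycleClass ρ₂.toTopRep z := by
    rw [cohomologyMap_threeCocycleClass]
    have hp : contThreeCocycles.pullback (ContinuousMonoidHom.id Γ) (resIdHom f) a' = z' - dψ :=
      Subtype.ext (ContinuousMap.ext fun ⟨σ, τ, υ⟩ => by
        rw [pullback₃_id_resIdHom_apply, ha', map_sub, hfa, hfe]
        rfl)
    rw [hp, threeCocycleClass_sub, threeCocycleClass_sub, hdβ, hdψ0, sub_zero, sub_zero]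
  /- Step 5: `[a']` is locally trivial at every real place. -/
  have ha'loc : ∀ w : InfinitePlace K, w.IsReal →
      galoisCohomology.localization ρ₁ (Sum.inl w) 3 (threeCocycleClass ρ₁.toTopRep a') = 0 := by
    intro w hw
    -- `[ψ|_w] = [g ∘ γ_w]`: the difference is the coboundary of some `θ : Γ_{K_w} → M₃`
    have hcw := hc w hw
    rw [hrr w hw, loc₂] at hcw
    have hcw' : twoCocycleClass (DiscreteGaloisModule.toTopRep (ρ₃.toLocal (Sum.inl w)))
        (contTwoCocycles.pullback (r w) (X := ρ₃.toTopRep)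
            (Y := DiscreteGaloisModule.toTopRep (ρ₃.toLocal (Sum.inl w)))
            (TopRep.ofHom ⟨ContinuousLinearMap.id ℤ M₃, fun _ => rfl⟩) ψ - ⟨_, hgγ w hw⟩) = 0 := by
      rw [twoCocycleClass_sub, sub_eq_zero]
      exact hcw
    obtain ⟨θ, hθ⟩ := (twoCocycleClass_eq_zero_iff _ _).1 hcw'
    have hθ' : ∀ σ τ, ψ.1 (r w σ, r w τ) - g.hom (γ w hw (σ, τ)) =
        ρ₃ (r w σ) (θ τ) - θ (σ * τ) + θ σ := fun σ τ => hθ σ τ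
    let θt : C(Γl w, M₂) := ⟨h.lift ∘ θ, (continuous_of_discreteTopology (f := h.lift)).comp θ.continuous⟩
    have hθt : ∀ σ, g.hom (θt σ) = θ σ := fun σ => h.g_lift _
    -- `κ⁰ = γ_w - ψ̃|_w + dθ̃` takes values in `ker g = im f`
    let κ₀ : C(Γl w × Γl w, M₂) :=
      γ w hw - ψt.comp ((r w : C(Γl w, Γ)).prodMap (r w : C(Γl w, Γ))) +
        ((ρ₂.toLocal (Sum.inl w)).twoCoboundary θt : contTwoCocycles _).1
    have hκ₀ : ∀ σ τ, κ₀ (σ, τ) =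
        γ w hw (σ, τ) - ψt (r w σ, r w τ) + (ρ₂ (r w σ) (θt τ) - θt (σ * τ) + θt σ) := fun σ τ => rfl
    have hκ₀g : ∀ σ τ, g.hom (κ₀ (σ, τ)) = 0 := fun σ τ => by
      rw [hκ₀, map_add, map_sub, map_add, map_sub, ContinuousRep.hom_comm_apply g (r w σ), hψt, hθt, hθt,
        hθt, ← hθ']
      abel
    let κ : C(Γl w × Γl w, M₁) := ⟨h.inv ∘ κ₀, (continuous_of_discreteTopology (f := h.inv)).comp κ₀.continuous⟩
    have hfκ : ∀ p, f.hom (κ p) = κ₀ p := fun p => h.f_inv (by obtain ⟨σ, τ⟩ := p; exact hκ₀g σ τ)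
    rw [loc₃]
    refine (threeCocycleClass_eq_zero_iff_dTwo _ _).2 ⟨κ, fun σ τ υ => ?_⟩
    apply h.injective
    change f.hom (a'.1 (r w σ, r w τ, r w υ)) =
      f.hom (dTwo (DiscreteGaloisModule.toTopRep (ρ₁.toLocal (Sum.inl w))) κ σ τ υ)
    have hfd : f.hom (dTwo (DiscreteGaloisModule.toTopRep (ρ₁.toLocal (Sum.inl w))) κ σ τ υ) =
        dTwo (DiscreteGaloisModule.toTopRep (ρ₂.toLocal (Sum.inl w))) κ₀ σ τ υ := by
      rw [dTwo_apply, dTwo_apply, map_sub, map_add, map_sub]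
      change f.hom (ρ₁ (r w σ) (κ (τ, υ))) - _ + _ - _ = ρ₂ (r w σ) (κ₀ (τ, υ)) - _ + _ - _
      rw [ContinuousRep.hom_comm_apply f (r w σ), hfκ, hfκ, hfκ, hfκ]
    rw [hfd, ha', map_sub, hfa, hfe, hγ w hw]
    -- `dκ⁰ = dγ_w - d(ψ̃|_w) + ddθ̃ = dγ_w - (dψ̃)|_w`
    have hsplit : dTwo (DiscreteGaloisModule.toTopRep (ρ₂.toLocal (Sum.inl w))) κ₀ σ τ υ =
        dTwo (DiscreteGaloisModule.toTopRep (ρ₂.toLocal (Sum.inl w))) (γ w hw) σ τ υ -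
          dTwo (DiscreteGaloisModule.toTopRep (ρ₂.toLocal (Sum.inl w)))
            (ψt.comp ((r w : C(Γl w, Γ)).prodMap (r w : C(Γl w, Γ)))) σ τ υ +
          dTwo (DiscreteGaloisModule.toTopRep (ρ₂.toLocal (Sum.inl w)))
            ((ρ₂.toLocal (Sum.inl w)).twoCoboundary θt : contTwoCocycles _).1 σ τ υ := by
      rw [← dTwo_sub, ← dTwo_add]
    rw [hsplit, dTwo_coe_contTwoCocycles, add_zero]
    congr 1
    rw [dTwo_apply, dTwo_apply]
    change _ = ρ₂ (r w σ) (ψt (r w τ, r w υ)) - ψt (r w (σ * τ), r w υ) + ψt (r w σ, r w (τ * υ)) -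
      ψt (r w σ, r w τ)
    rw [map_mul, map_mul]
    rfl
  /- Step 6: (h1) kills `[a']`, hence `x = f_*[a'] = 0`. -/
  have ha'0 : threeCocycleClass ρ₁.toTopRep a' = 0 := h1 _ ha'loc
  rw [← hfa', ha'0, map_zero]
  rfl

end Extension

/-! ## §2 The same step on the per-module instances of the two named facts -/

section NamedShape

variable {K : Type} [Field K] [NumberField K]
variable {M₁ M₂ M₃ : Type} [AddCommGroup M₁] [TopologicalSpace M₁] [DiscreteTopology M₁]
  [AddCommGroup M₂] [TopologicalSpace M₂] [DiscreteTopology M₂]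
  [AddCommGroup M₃] [TopologicalSpace M₃] [DiscreteTopology M₃]
variable {ρ₁ : DiscreteGaloisModule K M₁} {ρ₂ : DiscreteGaloisModule K M₂} {ρ₃ : DiscreteGaloisModule K M₃}
variable {f : ρ₁.toTopRep ⟶ ρ₂.toTopRep} {g : ρ₂.toTopRep ⟶ ρ₃.toTopRep}

/-- **Dévissage step for `poitouTate_three_realPlaces_injective` (Milne I Thm. 4.10 (c), `r = 3`).**  In a
short exact sequence `0 → M₁ → M₂ → M₃ → 0` of discrete `Γ_K`-modules, the body of the named fact
`poitouTate_three_realPlaces_injective K` AT `M₂` follows from its bodies AT `M₁` and AT `M₃` together with the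
body of `poitouTate_two_realPlaces_surjective K` (Milne I Cor. 4.16) AT `M₃`.
[cite: MilneADT2006, Ch. I, Thm. 4.10 (c) and Cor. 4.16] -/
theorem realThree_injective_of_extension (h : IsSES f g)
    (h1 : ∀ c : galoisCohomology ρ₁ 3,
      (∀ w : InfinitePlace K, w.IsReal → galoisCohomology.localization ρ₁ (Sum.inl w) 3 c = 0) → c = 0)
    (h3 : ∀ c : galoisCohomology ρ₃ 3,
      (∀ w : InfinitePlace K, w.IsReal → galoisCohomology.localization ρ₃ (Sum.inl w) 3 c = 0) → c = 0)
    (h2 : ∀ r : (∀ w : InfinitePlace K, galoisCohomology (ρ₃.toLocal (Sum.inl w)) 2),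
      ∃ c : galoisCohomology ρ₃ 2,
        ∀ w : InfinitePlace K, w.IsReal → galoisCohomology.localization ρ₃ (Sum.inl w) 2 c = r w) :
    ∀ c : galoisCohomology ρ₂ 3,
      (∀ w : InfinitePlace K, w.IsReal → galoisCohomology.localization ρ₂ (Sum.inl w) 3 c = 0) → c = 0 :=
  fun c hc => IsSES.eq_zero_of_forall_localization_inl_three h h1 h3 h2 c hc

/-- The same with (h3) and (h2) fed by the NAMED FACTS themselves (the generic facts at `M₃`), for the record:
if `poitouTate_three_realPlaces_injective K` and `poitouTate_two_realPlaces_surjective K` hold and `M₃` is finite,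
the degree-`3` injectivity AT a (not necessarily finite) submodule-quotient pair transfers from `M₁` to `M₂`.
[cite: MilneADT2006, Ch. I, Thm. 4.10 (c) and Cor. 4.16] -/
theorem realThree_injective_of_extension_of_poitouTate [Finite M₃] (h : IsSES f g)
    (hPT3 : poitouTate_three_realPlaces_injective K) (hPT2 : poitouTate_two_realPlaces_surjective K)
    (h1 : ∀ c : galoisCohomology ρ₁ 3,
      (∀ w : InfinitePlace K, w.IsReal → galoisCohomology.localization ρ₁ (Sum.inl w) 3 c = 0) → c = 0) :
    ∀ c : galoisCohomology ρ₂ 3,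
      (∀ w : InfinitePlace K, w.IsReal → galoisCohomology.localization ρ₂ (Sum.inl w) 3 c = 0) → c = 0 :=
  realThree_injective_of_extension h h1 (hPT3 M₃ ρ₃) (hPT2 M₃ ρ₃)

end NamedShape

end Summit.BirchSwinnertonDyer.BirchSwinnertonDyer.Theorems.SignedEC.ShaThree

end
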